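import Literature.NumberTheory.LFunctions.ConeCharacter
import Literature.NumberTheory.LFunctions.IdealCharacterPNT
import Literature.NumberTheory.LFunctions.LSeriesContinuationOfPartialSums
import HarnessLib

/-!
# Partial sums of a non-trivial cone character are `O(x^{1 − 1/(2d)})` (totally real fields)

Topic `Literature/NumberTheory/LFunctions`, sequel of `ConeCharacter.lean` (cone characters
`IsConeChar ν m` — Hecke's Grössencharaktere of conductor `1` of a totally real field on the ideals —
the sign character `Θ_ν`, and the identity `sum_twistCount_eq` expressing `∑_{n ≤ x} twistCount ν n`
through the twisted lattice sums of `TwistedConeCount`), of `TwistedConeCount.lean`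
(`norm_sum_eTwist_sub_le`: twisted lattice sums `= V_s(m)/covol · t^d + O(t^{d−1/2})`) and of
`TwistedConeIntegral.lean` (`V_s(m) = V_∅(m)`, `= 0` for a nonzero integral frequency).
Everything in this file is PROVED.

**Theorem (Hecke 1920, §2; Mitsui 1956, §1 — the "trivial" estimate of the character sums over the
ideals).** For a totally real number field `K` of degree `d` and a cone character `ν` of frequency
`m` which is not the trivial character (`m ≠ 0`, or `ν(𝔞) ≠ 1` for some `𝔞 ≠ 0`),
`∑_{N𝔞 ≤ x} ν(𝔞) = O(x^{1 − 1/(2d)})`; in particular `L(s, ν) = ∑ ν(𝔞) N𝔞^{-s}` continues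
analytically to `Re s > 1 − 1/(2d)` (by `LSeriesContinuationOfPartialSums`).

* `sum_signTheta_eq_zero_of_thetaVal_ne_one` — if `θ_ν(γ) ≠ 1` for some `γ ≠ 0` (e.g. a unit `u`
  with `e_m(ι u) ≠ 1`, or, for `m = 0`, a principal ideal with `ν ≠ 1`) then `∑_s Θ_ν(s) = 0`
  (translation of the sign patterns by `γ`);
* `exists_int_eq_of_forall_units` — if `e_m(ι u) = 1` for all units then `m ∈ ℤ^{rank}`;
* `sum_conj_classRep_eq_zero` — if `m = 0` and `ν` is `1` on all principal ideals but not on all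
  ideals, then `∑_C conj ν(J_C) = 0` (`ν` is a non-trivial character of the class group);
* `mainTerm_eq_zero` — hence `V_∅(m) · (∑_C conj ν(J_C)) · (∑_s Θ_ν(s)) = 0` for non-trivial `ν`;
* **`norm_sum_twistCount_le`** — `‖∑_{n ≤ x} twistCount ν n‖ ≤ C x^{1 − 1/(2d)}` for `x ≥ 1`.
* Part II: **`tendsto_sum_primes_mul_log_div`** — for `m ≠ 0`, `∑_{N𝔭 ≤ x} ν(𝔭) = o(x/log x)`
  (continuation by `LSeriesContinuationOfPartialSums`, `3-4-1` and Wiener–Ikehara by `IdealCharacterPNT`).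

## References

* E. Hecke, *Eine neue Art von Zetafunktionen …* II, Math. Z. 6 (1920), 11–51, §2. [HeckeMathZ1920]
* T. Mitsui, *Generalized prime number theorem*, Jap. J. Math. 26 (1956), 1–42, §1. [cite: Mitsui1956, §1]

## Mathlib / tree search

Mathlib: `logMap_eq_logEmbedding`, `logEmbedding_fundSystem`, `Basis.ofZLatticeBasis_repr_apply`,
`Complex.exp_eq_one_iff`, `ClassGroup.mk0_eq_mk0_iff`, `covolume_idealLattice`,
`Finset.sum_equiv`, `Equiv.symmDiff`? (we use `symmDiff_symmDiff_cancel_right`). Tree: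
`ConeCharacter`, `TwistedConeCount.norm_sum_eTwist_sub_le`, `TwistedConeIntegral`.
-/

noncomputable section

open NumberField NumberField.InfinitePlace NumberField.mixedEmbedding
  NumberField.mixedEmbedding.fundamentalCone NumberField.Units NumberField.Units.dirichletUnitTheorem
  MeasureTheory Module Set Finset Complex Bornology
open scoped Real NNReal Pointwise Classical nonZeroDivisors ComplexConjugate NumberField symmDiff

namespace Literature.NumberTheory.LFunctions.HeckeCone

variable {K : Type*} [Field K] [NumberField K]

/-! ## Translation of the sign patterns -/

omit [NumberField K] in
/-- The sign pattern of a product: `signSet(ι(γβ)) = signSet(ι γ) Δ signSet(ι β)` for `γ, β ≠ 0`.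
[folklore] -/
theorem signSet_mul {γ β : K} (hγ : γ ≠ 0) (hβ : β ≠ 0) :
    signSet (mixedEmbedding K (γ * β)) = signSet (mixedEmbedding K γ) ∆ signSet (mixedEmbedding K β) := by
  ext w
  simp only [signSet, Set.mem_symmDiff, Set.mem_setOf_eq, map_mul, Prod.fst_mul, Pi.mul_apply]
  have hg := fst_mixedEmbedding_ne_zero hγ w
  have hb := fst_mixedEmbedding_ne_zero hβ w
  rcases lt_or_gt_of_ne hg with hg' | hg' <;> rcases lt_or_gt_of_ne hb with hb' | hb'
  · have := mul_pos_of_neg_of_neg hg' hb'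
    constructor
    · intro h; linarith
    · rintro (⟨-, h⟩ | ⟨-, h⟩) <;> linarith
  · constructor
    · intro _; exact Or.inl ⟨hg'.le, not_le.2 hb'⟩
    · intro _; exact (mul_neg_of_neg_of_pos hg' hb').le
  · constructor
    · intro _; exact Or.inr ⟨hb'.le, not_le.2 hg'⟩
    · intro _; exact (mul_neg_of_pos_of_neg hg' hb').le
  · have := mul_pos hg' hb'
    constructor
    · intro h; linarith
    · rintro (⟨h, -⟩ | ⟨h, -⟩) <;> linarith

/-- `θ` is multiplicative: `θ(γβ) = θ(γ) θ(β)` for `γ, β ≠ 0`. [folklore] -/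
theorem thetaVal_mul (ν : Ideal (𝓞 K) →*₀ ℂ) (m : Fin (rank K) → ℝ) {γ β : 𝓞 K} (hγ : γ ≠ 0) (hβ : β ≠ 0) :
    thetaVal ν m (γ * β) = thetaVal ν m γ * thetaVal ν m β := by
  have hγK : (γ : K) ≠ 0 := RingOfIntegers.coe_ne_zero_iff.mpr hγ
  have hβK : (β : K) ≠ 0 := RingOfIntegers.coe_ne_zero_iff.mpr hβ
  unfold thetaVal
  rw [← Ideal.span_singleton_mul_span_singleton, map_mul]
  push_cast
  rw [map_mul, eTwist_mul m (norm_mixedEmbedding_ne_zero hγK) (norm_mixedEmbedding_ne_zero hβK), map_mul]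
  ring

/-- **Translation of the sign character**: `Θ_ν(signSet(ι γ) Δ s) = θ(γ) Θ_ν(s)` for `γ ≠ 0`.
[cite: Mitsui1956, §1] -/
theorem signTheta_symmDiff {ν : Ideal (𝓞 K) →*₀ ℂ} {m : Fin (rank K) → ℝ} (hν : IsConeChar K ν m)
    {γ : 𝓞 K} (hγ : γ ≠ 0) (s : Set {w : InfinitePlace K // IsReal w}) :
    signTheta ν m (signSet (mixedEmbedding K (γ : K)) ∆ s) = thetaVal ν m γ * signTheta ν m s := by
  have hγK : (γ : K) ≠ 0 := RingOfIntegers.coe_ne_zero_iff.mpr hγ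
  by_cases hs : ∃ β : 𝓞 K, β ≠ 0 ∧ signSet (mixedEmbedding K (β : K)) = s
  · obtain ⟨β, hβ, hβs⟩ := hs
    have hβK : (β : K) ≠ 0 := RingOfIntegers.coe_ne_zero_iff.mpr hβ
    have hγβ : γ * β ≠ 0 := mul_ne_zero hγ hβ
    have hsg : signSet (mixedEmbedding K ((γ * β : 𝓞 K) : K)) = signSet (mixedEmbedding K (γ : K)) ∆ s := by
      push_cast; rw [signSet_mul hγK hβK, hβs]
    -- both `Θ` values are attained, at `γβ` and `β`
    have h1 : signTheta ν m (signSet (mixedEmbedding K (γ : K)) ∆ s) = thetaVal ν m (γ * β) := by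
      have hex : ∃ β' : 𝓞 K, β' ≠ 0 ∧ signSet (mixedEmbedding K (β' : K)) = signSet (mixedEmbedding K (γ : K)) ∆ s :=
        ⟨γ * β, hγβ, hsg⟩
      rw [signTheta, dif_pos hex]
      exact thetaVal_eq_of_signSet_eq hν hex.choose_spec.1 hγβ (hex.choose_spec.2.trans hsg.symm)
    have h2 : signTheta ν m s = thetaVal ν m β := by
      have hex : ∃ β' : 𝓞 K, β' ≠ 0 ∧ signSet (mixedEmbedding K (β' : K)) = s := ⟨β, hβ, hβs⟩
      rw [signTheta, dif_pos hex]
      exact thetaVal_eq_of_signSet_eq hν hex.choose_spec.1 hβ (hex.choose_spec.2.trans hβs.symm)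
    rw [h1, h2, thetaVal_mul ν m hγ hβ]
  · -- neither is attained
    have hs' : ¬ ∃ β : 𝓞 K, β ≠ 0 ∧ signSet (mixedEmbedding K (β : K)) = signSet (mixedEmbedding K (γ : K)) ∆ s := by
      rintro ⟨β, hβ, hβs⟩
      have hβK : (β : K) ≠ 0 := RingOfIntegers.coe_ne_zero_iff.mpr hβ
      refine hs ⟨γ * β, mul_ne_zero hγ hβ, ?_⟩
      push_cast
      rw [signSet_mul hγK hβK, hβs, symmDiff_symmDiff_cancel_left]
    rw [signTheta, dif_neg hs', signTheta, dif_neg hs, mul_zero]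

/-- **`∑_s Θ_ν(s) = 0` as soon as `θ(γ) ≠ 1` for some `γ ≠ 0`** (translate the sign patterns by
`γ`). [cite: Mitsui1956, §1] -/
theorem sum_signTheta_eq_zero_of_thetaVal_ne_one {ν : Ideal (𝓞 K) →*₀ ℂ} {m : Fin (rank K) → ℝ}
    (hν : IsConeChar K ν m) {γ : 𝓞 K} (hγ : γ ≠ 0) (hθ : thetaVal ν m γ ≠ 1) :
    ∑ s : Set {w : InfinitePlace K // IsReal w}, signTheta ν m s = 0 := by
  set s₀ := signSet (mixedEmbedding K (γ : K)) with hs₀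
  -- translation by `s₀` is an involution of the sign patterns
  let e : Set {w : InfinitePlace K // IsReal w} ≃ Set {w : InfinitePlace K // IsReal w} :=
    { toFun := fun s ↦ s₀ ∆ s, invFun := fun s ↦ s₀ ∆ s,
      left_inv := fun s ↦ symmDiff_symmDiff_cancel_left s₀ s,
      right_inv := fun s ↦ symmDiff_symmDiff_cancel_left s₀ s }
  have hsum : ∑ s, signTheta ν m s = thetaVal ν m γ * ∑ s, signTheta ν m s := by
    calc ∑ s, signTheta ν m s = ∑ s, signTheta ν m (e s) := (Equiv.sum_comp e _).symm
      _ = ∑ s, thetaVal ν m γ * signTheta ν m s := Finset.sum_congr rfl fun s _ ↦ signTheta_symmDiff hν hγ s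
      _ = thetaVal ν m γ * ∑ s, signTheta ν m s := by rw [Finset.mul_sum]
  have : (1 - thetaVal ν m γ) * ∑ s, signTheta ν m s = 0 := by rw [sub_mul, one_mul, ← hsum, sub_self]
  exact (mul_eq_zero.1 this).resolve_left (sub_ne_zero.2 (Ne.symm hθ))

/-- `θ(u) = conj e_m(ι u)` for a unit `u` (`(u) = (1)`). [folklore] -/
theorem thetaVal_units (ν : Ideal (𝓞 K) →*₀ ℂ) (m : Fin (rank K) → ℝ) (u : (𝓞 K)ˣ) :
    thetaVal ν m (u : 𝓞 K) = conj (eTwist m (mixedEmbedding K ((u : 𝓞 K) : K))) := by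
  unfold thetaVal
  rw [Ideal.span_singleton_eq_top.2 u.isUnit, ← Ideal.one_eq_top, map_one, one_mul]

/-! ## Integrality of the frequency -/

/-- The cone coordinates of a fundamental unit are the corresponding basis vector. [folklore] -/
theorem coneCoord_fundSystem (i j : Fin (rank K)) :
    coneCoord (mixedEmbedding K ((fundSystem K i : 𝓞 K) : K)) j = if j = i then 1 else 0 := by
  unfold coneCoord
  have h1 : logMap (mixedEmbedding K ((fundSystem K i : 𝓞 K) : K)) = (basisUnitLattice K i : logSpace K) := by
    rw [show ((fundSystem K i : 𝓞 K) : K) = ((fundSystem K i : (𝓞 K)ˣ) : K) from rfl, logMap_eq_logEmbedding,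
      logEmbedding_fundSystem]
  have h2 : logBasis K i = (basisUnitLattice K i : logSpace K) := by simp [Basis.ofZLatticeBasis_apply]
  rw [h1, ← h2, Basis.repr_self, Finsupp.single_apply]
  rcases eq_or_ne j i with rfl | hne
  · simp
  · simp [hne, Ne.symm hne]

/-- `e_m(ι u_i) = e(m_i)` for the fundamental unit `u_i`. [folklore] -/
theorem eTwist_fundSystem (m : Fin (rank K) → ℝ) (i : Fin (rank K)) :
    eTwist m (mixedEmbedding K ((fundSystem K i : 𝓞 K) : K)) = Complex.exp (2 * π * Complex.I * m i) := by
  unfold eTwist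
  simp_rw [coneCoord_fundSystem, mul_ite, mul_one, mul_zero, Finset.sum_ite_eq', Finset.mem_univ, if_true]

/-- **If `e_m(ι u) = 1` for all units then the frequency is integral.** [cite: Mitsui1956, §1] -/
theorem exists_int_eq_of_forall_units {m : Fin (rank K) → ℝ}
    (h : ∀ u : (𝓞 K)ˣ, eTwist m (mixedEmbedding K ((u : 𝓞 K) : K)) = 1) (i : Fin (rank K)) :
    ∃ k : ℤ, m i = k := by
  have hi := h (fundSystem K i)
  rw [eTwist_fundSystem, Complex.exp_eq_one_iff] at hi
  obtain ⟨k, hk⟩ := hi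
  refine ⟨k, ?_⟩
  have h2 : (2 * π * Complex.I : ℂ) ≠ 0 := by
    refine mul_ne_zero (mul_ne_zero two_ne_zero ?_) Complex.I_ne_zero
    exact_mod_cast Real.pi_ne_zero
  have : ((m i : ℝ) : ℂ) = (k : ℂ) := by
    have e : (2 * π * Complex.I : ℂ) * (m i : ℂ) = (2 * π * Complex.I) * (k : ℂ) := by rw [hk]; ring
    exact mul_left_cancel₀ h2 e
  exact_mod_cast this

/-! ## The class sum for a character of the class group -/

/-- A cone character of frequency `0` which is `1` on all principal ideals only depends on the class.
[folklore] -/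
theorem apply_eq_of_mk0_eq {ν : Ideal (𝓞 K) →*₀ ℂ}
    (hprinc : ∀ γ : 𝓞 K, γ ≠ 0 → ν (Ideal.span {γ}) = 1) {I I' : Ideal (𝓞 K)} (hI : I ≠ ⊥) (hI' : I' ≠ ⊥)
    (h : ClassGroup.mk0 ⟨I, mem_nonZeroDivisors_of_ne_zero hI⟩ = ClassGroup.mk0 ⟨I', mem_nonZeroDivisors_of_ne_zero hI'⟩) :
    ν I = ν I' := by
  rw [ClassGroup.mk0_eq_mk0_iff] at h
  obtain ⟨x, y, hx, hy, hxy⟩ := h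
  have := congrArg ν hxy
  simp only [map_mul, hprinc x hx, hprinc y hy, one_mul] at this
  exact this

/-- **If `ν` is `1` on the principal ideals but not on all nonzero ideals then `∑_C conj ν(J_C) = 0`**
(`ν` induces a non-trivial character of the class group). [cite: Mitsui1956, §1] -/
theorem sum_conj_classRep_eq_zero {ν : Ideal (𝓞 K) →*₀ ℂ}
    (hprinc : ∀ γ : 𝓞 K, γ ≠ 0 → ν (Ideal.span {γ}) = 1) (hnt : ∃ I : Ideal (𝓞 K), I ≠ ⊥ ∧ ν I ≠ 1) :
    ∑ C : ClassGroup (𝓞 K), conj (ν (classRep C)) = 0 := by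
  -- `ψ C = ν(J_{C⁻¹})` is a function of the class with `ψ [I] = ν I`
  set ψ : ClassGroup (𝓞 K) → ℂ := fun C ↦ ν (classRep C⁻¹) with hψ
  have hψI : ∀ {I : Ideal (𝓞 K)} (hI : I ≠ ⊥), ψ (ClassGroup.mk0 ⟨I, mem_nonZeroDivisors_of_ne_zero hI⟩) = ν I := by
    intro I hI
    simp only [hψ]
    apply apply_eq_of_mk0_eq hprinc (classRep_ne_bot _) hI
    rw [mk0_classRep, inv_inv]
  have hψmul : ∀ C C', ψ (C * C') = ψ C * ψ C' := by
    intro C C'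
    obtain ⟨I, rfl⟩ := ClassGroup.mk0_surjective C
    obtain ⟨I', rfl⟩ := ClassGroup.mk0_surjective C'
    have hI : (I : Ideal (𝓞 K)) ≠ ⊥ := nonZeroDivisors.ne_zero I.2
    have hI' : (I' : Ideal (𝓞 K)) ≠ ⊥ := nonZeroDivisors.ne_zero I'.2
    have hII' : (I : Ideal (𝓞 K)) * (I' : Ideal (𝓞 K)) ≠ ⊥ := mul_ne_zero hI hI'
    have e1 : ClassGroup.mk0 I = ClassGroup.mk0 ⟨I, mem_nonZeroDivisors_of_ne_zero hI⟩ := rfl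
    have e2 : ClassGroup.mk0 I' = ClassGroup.mk0 ⟨I', mem_nonZeroDivisors_of_ne_zero hI'⟩ := rfl
    have e3 : ClassGroup.mk0 I * ClassGroup.mk0 I' =
        ClassGroup.mk0 ⟨(I : Ideal (𝓞 K)) * (I' : Ideal (𝓞 K)), mem_nonZeroDivisors_of_ne_zero hII'⟩ := by
      rw [← map_mul]; rfl
    rw [e3, hψI hII', e1, hψI hI, e2, hψI hI', map_mul]
  -- `ψ` is non-trivial
  obtain ⟨I₀, hI₀, hI₀1⟩ := hnt
  set C₀ := ClassGroup.mk0 ⟨I₀, mem_nonZeroDivisors_of_ne_zero hI₀⟩ with hC₀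
  have hψC₀ : ψ C₀ ≠ 1 := by rw [hψI hI₀]; exact hI₀1
  have hsumψ : ∑ C, ψ C = 0 := by
    have h := Fintype.sum_equiv (Equiv.mulLeft C₀) (fun C ↦ ψ (C₀ * C)) ψ fun C ↦ rfl
    have h' : ∑ C, ψ (C₀ * C) = ψ C₀ * ∑ C, ψ C := by
      rw [Finset.mul_sum]; exact Finset.sum_congr rfl fun C _ ↦ hψmul C₀ C
    have : (ψ C₀ - 1) * ∑ C, ψ C = 0 := by rw [sub_mul, one_mul, ← h', h, sub_self]
    exact (mul_eq_zero.1 this).resolve_left (sub_ne_zero.2 hψC₀)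
  -- the sum in question is `conj ∑_C ψ(C⁻¹) = conj ∑_C ψ C`
  have hre : ∑ C : ClassGroup (𝓞 K), conj (ν (classRep C)) = conj (∑ C, ψ C⁻¹) := by
    rw [map_sum]
    refine Finset.sum_congr rfl fun C _ ↦ ?_
    simp only [hψ, inv_inv]
  rw [hre, Fintype.sum_equiv (Equiv.inv _) (fun C ↦ ψ C⁻¹) ψ fun C ↦ rfl, hsumψ, map_zero]

/-! ## The main term vanishes -/

/-- **The main term of the partial sums of a non-trivial cone character vanishes** (`K` totally real):
`V_∅(m) · (∑_C conj ν(J_C)) · (∑_s Θ_ν(s)) = 0` when `m ≠ 0` or `ν ≠ 1` on some nonzero ideal.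
[cite: Mitsui1956, §1] -/
theorem mainTerm_eq_zero [IsTotallyReal K] {ν : Ideal (𝓞 K) →*₀ ℂ} {m : Fin (rank K) → ℝ} (hν : IsConeChar K ν m)
    (h : (∃ i, m i ≠ 0) ∨ ∃ I : Ideal (𝓞 K), I ≠ ⊥ ∧ ν I ≠ 1) :
    twistIntegral K ∅ m * (∑ C : ClassGroup (𝓞 K), conj (ν (classRep C))) *
      (∑ s : Set {w : InfinitePlace K // IsReal w}, signTheta ν m s) = 0 := by
  by_cases hT : ∃ γ : 𝓞 K, γ ≠ 0 ∧ thetaVal ν m γ ≠ 1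
  · obtain ⟨γ, hγ, hθ⟩ := hT
    rw [sum_signTheta_eq_zero_of_thetaVal_ne_one hν hγ hθ, mul_zero]
  push Not at hT
  -- all units have `e_m(ι u) = 1`, so `m` is integral
  have hunits : ∀ u : (𝓞 K)ˣ, eTwist m (mixedEmbedding K ((u : 𝓞 K) : K)) = 1 := by
    intro u
    have := hT u (Units.ne_zero u)
    rw [thetaVal_units] at this
    simpa using congrArg conj this
  by_cases hm : ∃ i, m i ≠ 0
  · obtain ⟨i, hi⟩ := hm
    obtain ⟨k, hk⟩ := exists_int_eq_of_forall_units hunits i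
    have hk0 : k ≠ 0 := by rintro rfl; exact hi (by rw [hk, Int.cast_zero])
    rw [twistIntegral_eq_zero ∅ hk0 hk, zero_mul, zero_mul]
  · push Not at hm
    have hm0 : m = 0 := funext hm
    -- `ν` is `1` on principal ideals
    have hprinc : ∀ γ : 𝓞 K, γ ≠ 0 → ν (Ideal.span {γ}) = 1 := by
      intro γ hγ
      have := hT γ hγ
      unfold thetaVal at this
      have he : eTwist m (mixedEmbedding K (γ : K)) = 1 := by
        unfold eTwist; rw [hm0]; simp
      rwa [he, map_one, mul_one] at this
    rcases h with ⟨i, hi⟩ | hnt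
    · exact absurd (hm i) hi
    · obtain ⟨I, hI, hI1⟩ := hnt
      rw [sum_conj_classRep_eq_zero hprinc ⟨I, hI, hI1⟩, mul_zero, zero_mul]

/-! ## The estimate -/

/-- `covol(ι(J)) = N(J) √|D_K|` for a nonzero integral ideal, in the form used here. [folklore] -/
theorem covolume_idealLattice_mk0 {J : Ideal (𝓞 K)} (hJ : J ≠ ⊥) :
    ZLattice.covolume (mixedEmbedding.idealLattice K (FractionalIdeal.mk0 K ⟨J, mem_nonZeroDivisors_of_ne_zero hJ⟩)) =
      (2 : ℝ)⁻¹ ^ nrComplexPlaces K * (Ideal.absNorm J * √|(discr K : ℝ)|) := by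
  rw [covolume_idealLattice, FractionalIdeal.coe_mk0, FractionalIdeal.coeIdeal_absNorm, Rat.cast_natCast]
  ring

/-- **Partial sums of a non-trivial cone character** (`K` totally real of degree `d`): if `m ≠ 0` or
`ν ≠ 1` on some nonzero ideal, there is `C` with `‖∑_{n ≤ x} twistCount ν n‖ ≤ C x^{1 − 1/(2d)}` for
all `x ≥ 1`. [cite: Mitsui1956, §1; HeckeMathZ1920, §2] -/
theorem norm_sum_twistCount_le [IsTotallyReal K] {ν : Ideal (𝓞 K) →*₀ ℂ} {m : Fin (rank K) → ℝ}
    (hν : IsConeChar K ν m) (h : (∃ i, m i ≠ 0) ∨ ∃ I : Ideal (𝓞 K), I ≠ ⊥ ∧ ν I ≠ 1) :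
    ∃ C : ℝ, ∀ x : ℝ, 1 ≤ x →
      ‖∑ n ∈ Finset.Icc 1 ⌊x⌋₊, NumberField.twistCount K ν n‖ ≤ C * x ^ (1 - 1 / (2 * (finrank ℚ K : ℝ))) := by
  haveI := isEmpty_isComplex (K := K)
  set d : ℕ := finrank ℚ K with hd
  have hd0 : (0 : ℝ) < d := by exact_mod_cast finrank_pos (R := ℚ) (M := K)
  have hd1 : (1 : ℝ) ≤ d := by exact_mod_cast (finrank_pos (R := ℚ) (M := K) : 1 ≤ finrank ℚ K)
  set D : ℝ := √|(discr K : ℝ)| with hD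
  have hDpos : 0 < D := Real.sqrt_pos.2 (abs_pos.2 (Int.cast_ne_zero.2 (discr_ne_zero K)))
  -- the error constants, class by class and sign by sign
  have hE : ∀ (C : ClassGroup (𝓞 K)) (s : Set {w : InfinitePlace K // IsReal w}), ∃ E : ℝ, 0 ≤ E ∧
      ∀ x : ℝ, 1 ≤ x →
        ‖(∑ ℓ ∈ latticePts K (classRep C) s (x * Ideal.absNorm (classRep C)), eTwist m ℓ) -
            twistIntegral K ∅ m / D * x‖ ≤ E * x ^ (1 - 1 / (2 * (d : ℝ))) := by
    intro C s
    set J := classRep C with hJdef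
    have hJ : J ≠ ⊥ := classRep_ne_bot C
    set N : ℝ := (Ideal.absNorm J : ℝ) with hN
    have hN1 : 1 ≤ N := by
      rw [hN]; exact_mod_cast Nat.one_le_iff_ne_zero.2 (by rw [Ne, Ideal.absNorm_eq_zero_iff]; exact hJ)
    have hN0 : 0 < N := by linarith
    set L := mixedEmbedding.idealLattice K (FractionalIdeal.mk0 K ⟨J, mem_nonZeroDivisors_of_ne_zero hJ⟩) with hL
    obtain ⟨E₀, hE₀⟩ := norm_sum_eTwist_sub_le L s m
    have hcov : ZLattice.covolume L = N * D := by
      rw [hL, covolume_idealLattice_mk0 hJ, IsTotallyReal.nrComplexPlaces_eq_zero, pow_zero, one_mul]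
    refine ⟨|E₀| * N ^ (1 - 1 / (2 * (d : ℝ))), by positivity, fun x hx ↦ ?_⟩
    have hx0 : 0 < x := by linarith
    set X : ℝ := x * N with hX
    have hX1 : 1 ≤ X := by rw [hX]; nlinarith
    have hX0 : 0 < X := by linarith
    set t : ℝ := X ^ (1 / (d : ℝ)) with ht
    have ht1 : 1 ≤ t := Real.one_le_rpow hX1 (by positivity)
    have htd : t ^ d = X := by
      rw [ht, ← Real.rpow_natCast, ← Real.rpow_mul hX0.le, one_div_mul_cancel hd0.ne', Real.rpow_one]
    have htexp : t ^ ((d : ℝ) - 1 / 2) = X ^ (1 - 1 / (2 * (d : ℝ))) := by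
      rw [ht, ← Real.rpow_mul hX0.le]
      congr 1
      field_simp
    have hmem := mem_latticePts hJ hX0 s
    have h1 := hE₀ t ht1 (latticePts K J s X) (fun ℓ ↦ (hmem ℓ).trans Iff.rfl)
    rw [hcov, twistIntegral_eq_twistIntegral_empty, htexp] at h1
    have hmain : twistIntegral K ∅ m / ((N * D : ℝ) : ℂ) * (t ^ d : ℝ) = twistIntegral K ∅ m / D * x := by
      rw [htd, hX]
      push_cast
      have hN0' : (N : ℂ) ≠ 0 := by exact_mod_cast hN0.ne'
      have hD0' : (D : ℂ) ≠ 0 := by exact_mod_cast hDpos.ne'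
      field_simp
    rw [hmain] at h1
    calc _ ≤ E₀ * X ^ (1 - 1 / (2 * (d : ℝ))) := h1
      _ ≤ |E₀| * X ^ (1 - 1 / (2 * (d : ℝ))) := by gcongr; exact le_abs_self _
      _ = |E₀| * N ^ (1 - 1 / (2 * (d : ℝ))) * x ^ (1 - 1 / (2 * (d : ℝ))) := by
          rw [hX, Real.mul_rpow hx0.le hN0.le]; ring
  choose E hE0 hEx using hE
  -- the total constant
  refine ⟨∑ C : ClassGroup (𝓞 K), 2⁻¹ * ∑ s : Set {w : InfinitePlace K // IsReal w}, E C s, fun x hx ↦ ?_⟩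
  have hx0 : 0 < x := by linarith
  have hr : 0 < nrRealPlaces K := nrRealPlaces_pos
  rw [sum_twistCount_eq hr hν hx0.le]
  -- split off the (vanishing) main term
  set R : ClassGroup (𝓞 K) → Set {w : InfinitePlace K // IsReal w} → ℂ := fun C s ↦
    (∑ ℓ ∈ latticePts K (classRep C) s (x * Ideal.absNorm (classRep C)), eTwist m ℓ) -
      twistIntegral K ∅ m / D * x with hR
  have hsplit : ∀ C s, ∑ ℓ ∈ latticePts K (classRep C) s (x * Ideal.absNorm (classRep C)), eTwist m ℓ =
      twistIntegral K ∅ m / D * x + R C s := fun C s ↦ by simp only [hR]; ring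
  simp_rw [hsplit, mul_add, Finset.sum_add_distrib, mul_add, Finset.sum_add_distrib]
  have hmain0 : ∑ C : ClassGroup (𝓞 K), conj (ν (classRep C)) *
      (2⁻¹ * ∑ s : Set {w : InfinitePlace K // IsReal w}, signTheta ν m s * (twistIntegral K ∅ m / D * x)) = 0 := by
    have e1 : ∀ C : ClassGroup (𝓞 K), conj (ν (classRep C)) *
        (2⁻¹ * ∑ s : Set {w : InfinitePlace K // IsReal w}, signTheta ν m s * (twistIntegral K ∅ m / D * x)) =
        conj (ν (classRep C)) * (∑ s : Set {w : InfinitePlace K // IsReal w}, signTheta ν m s) *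
          (2⁻¹ * (twistIntegral K ∅ m / D * x)) := fun C ↦ by rw [← Finset.sum_mul]; ring
    rw [Finset.sum_congr rfl (fun C _ ↦ e1 C), ← Finset.sum_mul, ← Finset.sum_mul]
    have h0 := mainTerm_eq_zero hν h
    calc (∑ C : ClassGroup (𝓞 K), conj (ν (classRep C))) * (∑ s : Set {w : InfinitePlace K // IsReal w}, signTheta ν m s) *
          (2⁻¹ * (twistIntegral K ∅ m / D * x))
        = (2⁻¹ * x / D) * (twistIntegral K ∅ m * (∑ C : ClassGroup (𝓞 K), conj (ν (classRep C))) *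
            ∑ s : Set {w : InfinitePlace K // IsReal w}, signTheta ν m s) := by ring
      _ = 0 := by rw [h0, mul_zero]
  rw [hmain0, zero_add]
  -- bound the error part
  calc ‖∑ C : ClassGroup (𝓞 K), conj (ν (classRep C)) *
          (2⁻¹ * ∑ s : Set {w : InfinitePlace K // IsReal w}, signTheta ν m s * R C s)‖
      ≤ ∑ C : ClassGroup (𝓞 K), ‖conj (ν (classRep C)) *
          (2⁻¹ * ∑ s : Set {w : InfinitePlace K // IsReal w}, signTheta ν m s * R C s)‖ := norm_sum_le _ _
    _ ≤ ∑ C : ClassGroup (𝓞 K), (2⁻¹ * ∑ s : Set {w : InfinitePlace K // IsReal w}, E C s) *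
          x ^ (1 - 1 / (2 * (d : ℝ))) := by
        refine Finset.sum_le_sum fun C _ ↦ ?_
        rw [norm_mul, Complex.norm_conj]
        have hν1 : ‖ν (classRep C)‖ ≤ 1 := hν.norm_le_one _
        have h2 : ‖(2⁻¹ : ℂ) * ∑ s : Set {w : InfinitePlace K // IsReal w}, signTheta ν m s * R C s‖ ≤
            2⁻¹ * ∑ s : Set {w : InfinitePlace K // IsReal w}, E C s * x ^ (1 - 1 / (2 * (d : ℝ))) := by
          rw [norm_mul, norm_inv, Complex.norm_ofNat]
          refine mul_le_mul_of_nonneg_left ((norm_sum_le _ _).trans (Finset.sum_le_sum fun s _ ↦ ?_)) (by norm_num)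
          rw [norm_mul]
          calc ‖signTheta ν m s‖ * ‖R C s‖ ≤ 1 * (E C s * x ^ (1 - 1 / (2 * (d : ℝ)))) :=
                mul_le_mul (norm_signTheta_le hν s) (hEx C s x hx) (norm_nonneg _) zero_le_one
            _ = E C s * x ^ (1 - 1 / (2 * (d : ℝ))) := one_mul _
        have h3 : 0 ≤ 2⁻¹ * ∑ s : Set {w : InfinitePlace K // IsReal w}, E C s * x ^ (1 - 1 / (2 * (d : ℝ))) := by
          have : ∀ s, 0 ≤ E C s * x ^ (1 - 1 / (2 * (d : ℝ))) := fun s ↦ by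
            have := hE0 C s; positivity
          exact mul_nonneg (by norm_num) (Finset.sum_nonneg fun s _ ↦ this s)
        calc ‖ν (classRep C)‖ * ‖(2⁻¹ : ℂ) * ∑ s : Set {w : InfinitePlace K // IsReal w}, signTheta ν m s * R C s‖
            ≤ 1 * (2⁻¹ * ∑ s : Set {w : InfinitePlace K // IsReal w}, E C s * x ^ (1 - 1 / (2 * (d : ℝ)))) :=
              mul_le_mul hν1 h2 (norm_nonneg _) zero_le_one
          _ = (2⁻¹ * ∑ s : Set {w : InfinitePlace K // IsReal w}, E C s) * x ^ (1 - 1 / (2 * (d : ℝ))) := by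
              rw [one_mul, ← Finset.sum_mul]; ring
    _ = (∑ C : ClassGroup (𝓞 K), 2⁻¹ * ∑ s : Set {w : InfinitePlace K // IsReal w}, E C s) *
          x ^ (1 - 1 / (2 * (d : ℝ))) := by rw [Finset.sum_mul]

/-! # Part II — the prime number theorem for cone characters of non-zero frequency

## The prime number theorem for the cone characters of non-zero frequency (Hecke, Mitsui)

Gluing Part I (partial sums of a non-trivial cone character of a totally real field are `O(x^{1−1/(2d)})`), `LSeriesContinuationOfPartialSums.lean`
(Landau: such partial sums continue `L(s, ν)` holomorphically to `Re s > 1 − 1/(2d)`, pole-free) and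
`IdealCharacterPNT.lean` (`3-4-1` non-vanishing on `Re s = 1`, Wiener–Ikehara, removal of the weight).
**Theorem (Hecke 1920, §7 "Primzahlsatz"; Mitsui 1956).** For a totally real number field `K` and a cone
character `ν` of NON-ZERO frequency `m` (a Grössencharakter of conductor `1` of infinite order),
`∑_{N𝔭 ≤ x} ν(𝔭) = o(x / log x)`: `tendsto_sum_primes_mul_log_div`.

* `mulChar ν ν'`, `conjChar ν` — the characters `νν'`, `ν̄` of the ideals, cone characters of
  frequencies `m + m'`, `−m` (`IsConeChar.mul`, `IsConeChar.conj`); in particular `ν² = mulChar ν ν`;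
* `exists_continuation` — the pole-free holomorphic continuation of `L(·, ν)` to `Re s > 1 − 1/(2d)` for a
  cone character with `m ≠ 0`;
* `exists_continuousOn_logTerm` — `∑_𝔭 ν(𝔭) log N𝔭 N𝔭^{-s}` is regular on `Re s ≥ 1`;
* **`tendsto_sum_primes_mul_log_div`** — `(∑_{N𝔭 ≤ N} ν(𝔭)) · log N / N → 0`.

## References

* E. Hecke, *Eine neue Art von Zetafunktionen …* II, Math. Z. 6 (1920), 11–51, §7. [HeckeMathZ1920]
* T. Mitsui, *Generalized prime number theorem*, Jap. J. Math. 26 (1956), 1–42. [cite: Mitsui1956, Lemma 5]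
-/

open Filter IsDedekindDomain Complex Finset _root_.Topology

/-! ## The square and the conjugate of a character of the ideals -/

/-- The pointwise product of two characters of the ideals. [folklore] -/
def mulChar (ν ν' : Ideal (𝓞 K) →*₀ ℂ) : Ideal (𝓞 K) →*₀ ℂ where
  toFun I := ν I * ν' I
  map_zero' := by rw [map_zero, zero_mul]
  map_one' := by rw [map_one, map_one, mul_one]
  map_mul' I J := by rw [map_mul, map_mul]; ring

omit [NumberField K] in
/-- Unfolding `mulChar`. [folklore] -/
@[simp] theorem mulChar_apply (ν ν' : Ideal (𝓞 K) →*₀ ℂ) (I : Ideal (𝓞 K)) : mulChar ν ν' I = ν I * ν' I := rfl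

/-- The character `𝔞 ↦ conj ν(𝔞)`. [folklore] -/
def conjChar (ν : Ideal (𝓞 K) →*₀ ℂ) : Ideal (𝓞 K) →*₀ ℂ where
  toFun I := conj (ν I)
  map_zero' := by rw [map_zero, map_zero]
  map_one' := by rw [map_one, map_one]
  map_mul' I J := by rw [map_mul, map_mul]

omit [NumberField K] in
/-- Unfolding lemma for `conjChar`. [folklore] -/
@[simp] theorem conjChar_apply (ν : Ideal (𝓞 K) →*₀ ℂ) (I : Ideal (𝓞 K)) : conjChar ν I = conj (ν I) := rfl

/-- `e_{m+m'} = e_m e_{m'}`. [folklore] -/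
theorem eTwist_add (m m' : Fin (rank K) → ℝ) (x : mixedSpace K) :
    eTwist (m + m') x = eTwist m x * eTwist m' x := by
  unfold eTwist
  rw [← Complex.exp_add]
  congr 1
  simp only [Pi.add_apply, add_mul, Finset.sum_add_distrib]
  push_cast; ring

/-- `e_{−m}(x) = conj e_m(x)`. [folklore] -/
theorem eTwist_neg (m : Fin (rank K) → ℝ) (x : mixedSpace K) :
    eTwist (fun i ↦ -m i) x = conj (eTwist m x) := by
  unfold eTwist
  rw [← Complex.exp_conj]
  congr 1
  simp only [map_mul, Complex.conj_ofReal, Complex.conj_I, map_ofNat, neg_mul, Finset.sum_neg_distrib]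
  push_cast
  ring

/-- **The product of cone characters is a cone character, frequencies add.** [folklore] -/
theorem IsConeChar.mul {ν ν' : Ideal (𝓞 K) →*₀ ℂ} {m m' : Fin (rank K) → ℝ} (h : IsConeChar K ν m)
    (h' : IsConeChar K ν' m') : IsConeChar K (mulChar ν ν') (m + m') where
  norm_eq_one I hI := by rw [mulChar_apply, norm_mul, h.norm_eq_one I hI, h'.norm_eq_one I hI, mul_one]
  apply_span_eq β hβ hpos := by rw [mulChar_apply, h.apply_span_eq β hβ hpos, h'.apply_span_eq β hβ hpos, eTwist_add]

/-- **`ν̄` is a cone character of frequency `−m`.** [folklore] -/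
theorem IsConeChar.conj {ν : Ideal (𝓞 K) →*₀ ℂ} {m : Fin (rank K) → ℝ} (h : IsConeChar K ν m) :
    IsConeChar K (conjChar ν) (fun i ↦ -m i) where
  norm_eq_one I hI := by rw [conjChar_apply, Complex.norm_conj, h.norm_eq_one I hI]
  apply_span_eq β hβ hpos := by rw [conjChar_apply, h.apply_span_eq β hβ hpos, eTwist_neg]

/-- A non-zero frequency stays non-zero when doubled. [folklore] -/
theorem exists_add_self_ne_zero {m : Fin (rank K) → ℝ} (hm : ∃ i, m i ≠ 0) : ∃ i, (m + m) i ≠ 0 := by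
  obtain ⟨i, hi⟩ := hm; exact ⟨i, by rw [Pi.add_apply]; intro h; exact hi (by linarith)⟩

/-- A non-zero frequency stays non-zero when negated. [folklore] -/
theorem exists_neg_ne_zero {m : Fin (rank K) → ℝ} (hm : ∃ i, m i ≠ 0) : ∃ i, -m i ≠ 0 := by
  obtain ⟨i, hi⟩ := hm; exact ⟨i, neg_ne_zero.2 hi⟩

/-! ## The pole-free continuation of `L(s, ν)` -/

/-- **Landau's continuation of `L(s, ν)` for a cone character of non-zero frequency** (`K` totally real of
degree `d`): there is `F`, holomorphic on `Re s > 1 − 1/(2d)`, with `F(s) = L(twistCount ν, s)` for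
`Re s > 1`. [cite: Mitsui1956, §1; LandauMathAnn1903, §9 p. 666] -/
theorem exists_continuation [IsTotallyReal K] {ν : Ideal (𝓞 K) →*₀ ℂ} {m : Fin (rank K) → ℝ}
    (hν : IsConeChar K ν m) (hm : ∃ i, m i ≠ 0) :
    ∃ F : ℂ → ℂ, DifferentiableOn ℂ F {s : ℂ | 1 - 1 / (2 * (Module.finrank ℚ K : ℝ)) < s.re} ∧
      ∀ s : ℂ, 1 < s.re → F s = LSeries (NumberField.twistCount K ν) s := by
  set θ : ℝ := 1 - 1 / (2 * (Module.finrank ℚ K : ℝ)) with hθ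
  have hd : (1 : ℝ) ≤ Module.finrank ℚ K := by exact_mod_cast Module.finrank_pos (R := ℚ) (M := K)
  have hθ0 : 0 ≤ θ := by
    rw [hθ, sub_nonneg, div_le_one (by positivity)]; linarith
  have hpos : 0 < 1 / (2 * (Module.finrank ℚ K : ℝ)) := by positivity
  have hθ1 : θ ≤ 1 := by rw [hθ]; linarith
  obtain ⟨C, hC⟩ := norm_sum_twistCount_le hν (Or.inl hm)
  have hA : ∀ N : ℕ, 1 ≤ N → ‖∑ k ∈ Icc 1 N, NumberField.twistCount K ν k‖ ≤ C * (N : ℝ) ^ θ := by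
    intro N hN
    have h := hC N (by exact_mod_cast hN)
    rwa [Nat.floor_natCast] at h
  refine ⟨PartialSumContinuation.contF (NumberField.twistCount K ν), PartialSumContinuation.differentiableOn_contF hθ0 hA,
    fun s hs ↦ PartialSumContinuation.contF_eq_LSeries hθ0 hA hθ1 hs
      (NumberField.LSeriesSummable_twistCount hν.norm_le_one hs)⟩

/-- **`∑_𝔭 ν(𝔭) log N𝔭 · N𝔭^{-s}` is regular on `Re s ≥ 1`** for a cone character of non-zero frequency of a
totally real field. [cite: HeckeMathZ1920, §7] -/
theorem exists_continuousOn_logTerm [IsTotallyReal K] {ν : Ideal (𝓞 K) →*₀ ℂ} {m : Fin (rank K) → ℝ}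
    (hν : IsConeChar K ν m) (hm : ∃ i, m i ≠ 0) :
    ∃ r : ℂ → ℂ, ContinuousOn r {s : ℂ | 1 ≤ s.re} ∧
      ∀ s : ℂ, 1 < s.re → r s =
        ∑' v : HeightOneSpectrum (𝓞 K), ν v.asIdeal *
          (Real.log ((Ideal.absNorm v.asIdeal : ℕ) : ℝ) : ℂ) * ((Ideal.absNorm v.asIdeal : ℕ) : ℂ) ^ (-s) := by
  obtain ⟨F, hF, hFeq⟩ := exists_continuation hν hm
  obtain ⟨F₂, hF₂, hF₂eq⟩ := exists_continuation (hν.mul hν) (exists_add_self_ne_zero hm)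
  have hU : IsOpen {s : ℂ | 1 - 1 / (2 * (Module.finrank ℚ K : ℝ)) < s.re} :=
    isOpen_lt continuous_const Complex.continuous_re
  have hU1 : {s : ℂ | 1 ≤ s.re} ⊆ {s : ℂ | 1 - 1 / (2 * (Module.finrank ℚ K : ℝ)) < s.re} := by
    intro s hs
    have : 0 < 1 / (2 * (Module.finrank ℚ K : ℝ)) := by
      have hd : (0 : ℝ) < Module.finrank ℚ K := by exact_mod_cast Module.finrank_pos (R := ℚ) (M := K)
      positivity
    show 1 - 1 / (2 * (Module.finrank ℚ K : ℝ)) < s.re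
    have hs' : (1 : ℝ) ≤ s.re := hs
    linarith
  exact IdealCharPNT.exists_continuousOn_eq_tsum_logTerm ν (mulChar ν ν) hν.norm_le_one
    (fun I ↦ by rw [mulChar_apply, pow_two]) hU hU1
    hF hFeq hF₂ hF₂eq

/-- **The prime number theorem for a cone character of non-zero frequency of a totally real field**
(Hecke's "Primzahlsatz" for Grössencharaktere; Mitsui): `(∑_{N𝔭 ≤ N} ν(𝔭)) · log N / N → 0`, i.e.
`∑_{N𝔭 ≤ x} ν(𝔭) = o(x / log x)`. [cite: HeckeMathZ1920, §7; Mitsui1956, Lemma 5] -/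
theorem tendsto_sum_primes_mul_log_div [IsTotallyReal K] {ν : Ideal (𝓞 K) →*₀ ℂ} {m : Fin (rank K) → ℝ}
    (hν : IsConeChar K ν m) (hm : ∃ i, m i ≠ 0) :
    Tendsto (fun N : ℕ ↦ (∑ n ∈ Icc 1 N, ∑ v ∈ primesOfNorm K n, ν v.asIdeal) * (Real.log N : ℂ) / N)
      atTop (𝓝 0) := by
  have hr := exists_continuousOn_logTerm hν hm
  have hr' := exists_continuousOn_logTerm hν.conj (exists_neg_ne_zero hm)
  exact IdealCharPNT.tendsto_sum_mul_log_div ν hν.norm_le_one hr (by simpa using hr')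


end Literature.NumberTheory.LFunctions.HeckeCone

end
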